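import Literature.AlgebraicGeometry.Resolution.GeneralizedStabilityTrdegOne
import Literature.AlgebraicGeometry.Resolution.CompositeValuations
import HarnessLib

/-!
# Generalized stability for `K(t)` over an algebraically closed field: reduction to finite rank (Kuhlmann 2010, Lemma 5.3)

Topic: `Literature/AlgebraicGeometry/Resolution` (valued function fields). Fourth layer of the
decomposition of the named fact `Kuhlmann2010Stability` (`ValuationDefect.lean`) = F.-V. Kuhlmann,
*Elimination of ramification I: The generalized stability theorem*, Trans. AMS 362 (2010)
5697–5727 = arXiv:1003.5678, **Thm. 1.1**, along the printed proof (§5, pp. 18–20 of the arXiv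
version). After `GeneralizedStability.lean` (Cor. 2.6, Cor. 2.16), `GeneralizedStabilityRational.lean`
(Lemma 5.1) and `GeneralizedStabilityTrdegOne.lean` (Lemma 5.2) the theorem over a trivially
valued ground field rests on the fundamental inequality, on Cor. 2.25, and on
`Kuhlmann2010StabilityAlgClosedValueTranscendental` = statement (R2) of §5 for a valued rational
function field `F = K(t)` with a value-transcendental generator over an ALGEBRAICALLY CLOSED
field `K`:

> (R2) Every valued function field of transcendence degree 1 without transcendence defect over
> an algebraically closed field is a defectless field.

The third step of §5 is the reduction to ground fields of finite rank:

> **Lemma 5.3.** To prove (R2), it suffices to prove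
> (R3) Every valued function field of transcendence degree 1 without transcendence defect over
> an algebraically closed ground field of finite rank is a defectless field.
> *Proof.* Let `(F|K,v)` satisfy the assumptions of (R2). We wish to show that `(F,v)` is a
> defectless field. As in the preceding proof, we choose a valuation transcendental element `t`,
> and by Corollary 2.16 we only have to show that `(K(t),v)` is a defectless field. By Theorem 2.14
> we may as well show that `(K(t)^h,v)` is a defectless field. Let `(K(t)^h(a₁,…,a_n)|K(t)^h,v)`
> be an arbitrary finite extension; we have to show that it is defectless. There exists a finitely
> generated extension `k₁` of the prime field of `K` such that `a₁,…,a_n` are already algebraic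
> over `k₁(t)`. We take `k` to be the algebraic closure of `k₁` inside `K`. Since `k₁` is finitely
> generated over its prime field, the rank of `(k₁,v)` and thus also of its algebraic closure
> `(k,v)` must be finite by Lemma 2.7. By construction, `(k(t)|k,v)` is a valued function field of
> transcendence degree 1 without transcendence defect over the algebraically closed ground field
> `(k,v)` of finite rank. So (R3) together with Theorem 2.14 implies that
> `(k(t)^h(a₁,…,a_n)|k(t)^h,v)` is a defectless extension. Since `k` is algebraically closed,
> Lemma 2.20 shows that the extension `(K|k,v)` is valuation regular. By Lemma 2.23 and
> Corollary 2.21, also the extensions `(K(t)|k(t),v)` and `(K(t)^h|k(t)^h,v)` are valuation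
> regular. Hence the algebraic extension `(k(t)^h(a₁,…,a_n)|k(t)^h,v)` is valuation disjoint from
> `(K(t)^h|k(t)^h,v)`. Now we apply Lemma 2.24 to obtain that
> `d(K(t)^h(a₁,…,a_n)|K(t)^h,v) ≤ d(k(t)^h(a₁,…,a_n)|k(t)^h,v) = 1`. We have thus proved that
> `(K(t)^h,v)` is a defectless field.

with (§2.1, p. 5) "The rank of a valued field `(K,v)` is the order type of the chain of
non-trivial convex subgroups of its value group `vK`", (Cor. 2.7) "Every valued field of finite
transcendence degree over its prime field has finite rank" and (Thm. 2.14) "`(K,v)` is defectless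
if and only if its henselization `(K,v)^h` in `(K̃,v)` is defectless". This file vendors the two
inputs of this step for `F = K(t)` as named facts — the content of the proof of Lemma 5.3
(`Kuhlmann2010AlgClosedFiniteRankReduction`: `(K(t), v)` is a defectless field as soon as
`(k(t), v)` is one for every algebraically closed subfield `k ⊆ K` over which `k(t)` has finite
rank; its printed proof rests on henselizations — Thm. 2.14, Cor. 2.21, Prop. 2.24 —, which
Mathlib does not have) and (R3) for `k(t)` (`Kuhlmann2010StabilityAlgClosedFiniteRank`; printed
proof = Lemma 5.4, the reduction to rank `1` through composite valuations, Lemmas 2.8 and 2.17,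
and the proof of (R4), pp. 19–20: ramification theory, Lemma 2.27, Prop. 2.18, the
Artin–Schreier and Kummer normal forms of §4, Prop. 3.1, Lemma 5.5) — and PROVES the assembly
`Kuhlmann2010StabilityAlgClosedValueTranscendental.of_parts`.

## Content

* `Kuhlmann2010AlgClosedFiniteRankReduction` — NAMED FACT: Lemma 5.3 (its proof) for `F = K(t)`,
  `K` algebraically closed, `t` value-transcendental: if `(k(t), v)` is a defectless field for
  every algebraically closed field `k ⊆ K` such that `(k(t), v)` has finite rank, then `(K(t), v)`
  is a defectless field.
* `Kuhlmann2010StabilityAlgClosedFiniteRank` — NAMED FACT: (R3) for `F = K(t)`, `K` algebraically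
  closed, `t` value-transcendental, `(F, v)` of finite rank: `(F, v)` is a defectless field.
* `Kuhlmann2010StabilityAlgClosedValueTranscendental.of_parts :
  Kuhlmann2010AlgClosedFiniteRankReduction → Kuhlmann2010StabilityAlgClosedFiniteRank →
  Kuhlmann2010StabilityAlgClosedValueTranscendental` — PROVED (for `k ⊆ K` algebraically closed,
  `t` stays value-transcendental over `k` since `vk ⊆ vK`, and `k(t)` is generated by `t` over
  `k`, so (R3) applies to `(k(t)|k, v)`).

Hence `Kuhlmann2010Stability` follows from `FundamentalInequality`, `Kuhlmann2010DefectlessDescent`,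
`Kuhlmann2010AlgClosedFiniteRankReduction` and `Kuhlmann2010StabilityAlgClosedFiniteRank`
(`Kuhlmann2010Stability.of_descent_of_finiteRank`).

## Sources

* F.-V. Kuhlmann, *Elimination of ramification I: The generalized stability theorem*, Trans.
  Amer. Math. Soc. 362 (2010) 5697–5727 = arXiv:1003.5678: §2.1 (rank, composite valuations,
  Lemma 2.5, Cor. 2.7, Lemma 2.8), §2.3 (Thm. 2.14, Lemma 2.17, Prop. 2.18), §2.4 (Lemma 2.20,
  Cor. 2.21, Lemma 2.23, Prop. 2.24), §2.5 (value-transcendental elements, Lemma 2.27), §4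
  (Cor. 4.2, Props. 4.5, 4.6), §5 (Lemmas 5.3, 5.4, proof of (R4), Lemma 5.5), pp. 5–9, 18–20.

## Rendering notes

* As in the previous layers, an extension of valued fields is `[Algebra K F]` plus
  `O : ValuationSubring F` (`K° = O.comap (algebraMap K F)`); "`F = K(t)`" is
  `IntermediateField.adjoin K {t} = ⊤`; "`t` value-transcendental over `K`" is
  `∀ n ≥ 1, ∀ c : K, v(t)^n ≠ v(c)`.
* **Rank.** The convex subgroups of `vF` correspond to the prime ideals of `F° = O` and to the
  overrings `O ≤ S ≤ F` of `O` in `F` (Mathlib's `ValuationSubring.primeSpectrumOrderEquiv`), the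
  currency of `CompositeValuations.lean`; "`(F, v)` has finite rank" is rendered as
  `Finite {S : ValuationSubring F // O ≤ S}`. In (R3) the source asks the GROUND field to have
  finite rank and notes (proof of Lemma 5.4) "Then `(F,v)` must also have finite rank (cf. (2) and
  note that the rank of `vF` cannot exceed the rank of `vK` plus `rr vF/vK`)"; conversely a
  subfield never has larger rank (`card_overrings_comap_le`), so for `F = K(t)` the two
  finiteness conditions agree and the facts below carry the one on `(K(t), v)`, which is what the
  reduction to rank one (Lemma 5.4) inducts on. Accordingly the hypothesis of
  `Kuhlmann2010AlgClosedFiniteRankReduction` asks defectlessness of `(k(t), v)` only for those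
  algebraically closed `k ⊆ K` over which `(k(t), v)` has finite rank: the field `k` of the
  printed proof (the algebraic closure in `K` of a finitely generated field `k₁`) has finite
  transcendence degree over the prime field, and so has `k(t)`, whence finite rank by Cor. 2.7.
* The subfields `k ⊆ K` are rendered as fields `k` with `[Algebra k K] [Algebra k F]
  [IsScalarTower k K F]` (field maps are injective), `k(t) = IntermediateField.adjoin k {t} ⊆ F`
  with the restriction `O.comap (algebraMap k(t) F)` of `O`.
-/

noncomputable section

open IsLocalRing

namespace Literature.AlgebraicGeometry.Resolution

universe u

/-! ### Lemma 5.3 and (R3) for `K(t)` (named facts) -/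

/-- NAMED FACT — **Kuhlmann 2010, Lemma 5.3 (reduction of (R2) to ground fields of finite rank),
for `F = K(t)` with a value-transcendental generator.** Lemma 5.3: "To prove (R2), it suffices to
prove (R3) Every valued function field of transcendence degree 1 without transcendence defect
over an algebraically closed ground field of finite rank is a defectless field"; its proof shows,
for `(K(t)|K, v)` with `K` algebraically closed: every finite extension `K(t)^h(a₁,…,a_n)` of the
henselization is defectless, because the `aᵢ` are algebraic over `k₁(t)` for a finitely generated
field `k₁ ⊆ K`, whose algebraic closure `k` in `K` is an algebraically closed field of finite rank
(Cor. 2.7), so that "(R3) together with Theorem 2.14 implies that `(k(t)^h(a₁,…,a_n)|k(t)^h,v)`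
is a defectless extension", and `d(K(t)^h(a₁,…,a_n)|K(t)^h,v) ≤ d(k(t)^h(a₁,…,a_n)|k(t)^h,v) = 1`
by valuation regularity of `(K(t)^h|k(t)^h, v)` (Lemma 2.20, Lemma 2.23, Cor. 2.21) and
Prop. 2.24; finally "(K(t),v) is defectless if and only if its henselization is" (Thm. 2.14).
Statement (the content of this proof, with the use of (R3) for `(k(t)|k, v)` kept as the
hypothesis): `K` algebraically closed, `F = K(t)`, `t` value-transcendental over `K` with respect
to `O = F°`; if for every algebraically closed field `k ⊆ K` such that `(k(t), O ∩ k(t))` has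
finite rank (finitely many overrings — automatic for the `k` of the printed proof by Cor. 2.7,
`k(t)` having finite transcendence degree over the prime field) the valued field
`(k(t), O ∩ k(t))` is defectless, then `(F, O)` is a defectless field. The printed proof rests on
henselizations of valued fields (Thm. 2.14, Cor. 2.21, Prop. 2.24: "`[(L.F)^h:F^h] ≤ [L^h:K^h]`"),
which Mathlib does not have. Users take `(h : Kuhlmann2010AlgClosedFiniteRankReduction)`.
[cite: Kuhlmann2010, Section 5, Lemma 5.3 (proof), with Thm. 2.14, Cor. 2.7, Lemma 2.20, Cor. 2.21, Lemma 2.23, Prop. 2.24] -/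
def Kuhlmann2010AlgClosedFiniteRankReduction : Prop :=
  ∀ (K F : Type u) [Field K] [Field F] [Algebra K F] [IsAlgClosed K] (O : ValuationSubring F)
    (t : F), (∀ n : ℕ, 0 < n → ∀ c : K, O.valuation t ^ n ≠ O.valuation (algebraMap K F c)) →
    IntermediateField.adjoin K ({t} : Set F) = ⊤ →
    (∀ (k : Type u) [Field k] [Algebra k K] [Algebra k F] [IsScalarTower k K F] [IsAlgClosed k],
      Finite {S : ValuationSubring (IntermediateField.adjoin k ({t} : Set F)) //
        O.comap (algebraMap (IntermediateField.adjoin k ({t} : Set F)) F) ≤ S} →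
      IsDefectlessField (IntermediateField.adjoin k ({t} : Set F))
        (O.comap (algebraMap (IntermediateField.adjoin k ({t} : Set F)) F))) →
    IsDefectlessField F O

/-- NAMED FACT — **Kuhlmann 2010, (R3) for a valued rational function field with a
value-transcendental generator over an algebraically closed field, of finite rank** (§5,
Lemma 5.3: "(R3) Every valued function field of transcendence degree 1 without transcendence
defect over an algebraically closed ground field of finite rank is a defectless field"; §2.1:
"The rank of a valued field `(K,v)` is the order type of the chain of non-trivial convex subgroups
of its value group `vK`"; §2.5: "a value-transcendental element `x ∈ F`, i.e., its value `vx` is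
rationally independent over `vK`"). Statement: `K` algebraically closed, `F = K(t)` with
`n·vt ∉ vK` for all `n ≥ 1` — so `(F|K, v)` is a valued function field of transcendence degree
`1 = rr vF/vK` without transcendence defect (Lemma 2.5) — and `(F, F°)` of finite rank (finitely
many overrings of `F°`; then the subfield `K` has finite rank too, and conversely, proof of
Lemma 5.4: "Then `(F,v)` must also have finite rank (cf. (2) and note that the rank of `vF` cannot
exceed the rank of `vK` plus `rr vF/vK`)"); then `(F, F°)` is a defectless field. Its printed
proof is Lemma 5.4 ((R3) ⇐ (R4): "Let `v = w₁∘…∘w_n` be the decomposition of `v` into valuations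
`wᵢ` of rank 1 … By a repeated application of Lemma 2.8 … (R4) yields that every
`(Fw₁∘…∘wᵢ, w_{i+1})` is a defectless field. Now a repeated application of Lemma 2.17 shows that
`(F,v)` itself is a defectless field") and the proof of (R4) (pp. 19–20: henselization `K(x)^h`,
Thm. 2.14; the ramification group is a `p`-group, so `E.F^r|F^r` is a tower of normal extensions
of degree `p`; Lemma 2.27, Prop. 2.18, Cor. 4.2 = the Artin–Schreier and Kummer normal forms
Props. 4.5–4.6 and §§4.2–4.3, Prop. 3.1, Lemma 5.5), resting on henselizations and ramification
theory of valued fields, not available in Mathlib. Users take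
`(h : Kuhlmann2010StabilityAlgClosedFiniteRank)`.
[cite: Kuhlmann2010, Section 5, Lemma 5.3 (R3) and Lemma 5.4] -/
def Kuhlmann2010StabilityAlgClosedFiniteRank : Prop :=
  ∀ (K F : Type u) [Field K] [Field F] [Algebra K F] [IsAlgClosed K] (O : ValuationSubring F)
    (t : F), (∀ n : ℕ, 0 < n → ∀ c : K, O.valuation t ^ n ≠ O.valuation (algebraMap K F c)) →
    IntermediateField.adjoin K ({t} : Set F) = ⊤ → Finite {S : ValuationSubring F // O ≤ S} →
    IsDefectlessField F O

/-! ### Assembly: (R2) for `K(t)` from Lemma 5.3 and (R3) -/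

/-- **Kuhlmann 2010, (R2) for `K(t)` with `t` value-transcendental over the algebraically closed
`K`, from Lemma 5.3 and (R3)** ("To prove (R2), it suffices to prove (R3)"). PROVED: for an
algebraically closed field `k ⊆ K`, the generator `t` is value-transcendental over `k` as well
(`vk ⊆ vK`, values transported along `k(t) ⊆ F` by `valueGroupHom`), and `k(t) ⊆ F` is generated
over `k` by `t`; so (R3) (`Kuhlmann2010StabilityAlgClosedFiniteRank`) makes `(k(t), v)` defectless
whenever it has finite rank, which is the hypothesis of `Kuhlmann2010AlgClosedFiniteRankReduction`.
[cite: Kuhlmann2010, Section 5, Lemma 5.3] -/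
theorem Kuhlmann2010StabilityAlgClosedValueTranscendental.of_parts
    (hA : Kuhlmann2010AlgClosedFiniteRankReduction.{u})
    (hB : Kuhlmann2010StabilityAlgClosedFiniteRank.{u}) :
    Kuhlmann2010StabilityAlgClosedValueTranscendental.{u} := by
  intro K F _ _ _ _ O t hvt hgen
  refine hA K F O t hvt hgen fun k _ _ _ _ _ hfin => ?_
  set M : IntermediateField k F := IntermediateField.adjoin k ({t} : Set F) with hM
  have htM : t ∈ M := IntermediateField.subset_adjoin _ _ rfl
  refine hB k M (O.comap (algebraMap M F)) ⟨t, htM⟩ ?_ ?_ hfin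
  · -- `t` is value-transcendental over `k ⊆ K`
    intro n hn c h
    have h' : O.valuation t ^ n = O.valuation (algebraMap k F c) := by
      have h1 := congrArg (valueGroupHom M O) h
      rw [map_pow, valueGroupHom_valuation, valueGroupHom_valuation,
        ← IsScalarTower.algebraMap_apply k M F] at h1
      exact h1
    refine hvt n hn (algebraMap k K c) ?_
    rw [h', IsScalarTower.algebraMap_apply k K F]
  · -- `k(t)` is generated over `k` by `t`
    apply IntermediateField.lift_injective M
    rw [IntermediateField.lift_adjoin, IntermediateField.lift_top, Set.image_singleton]

/-- **Kuhlmann 2010, Thm. 1.1 over a trivially valued ground field** from the fundamental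
inequality (1), Cor. 2.25, Lemma 5.3 and (R3) for `k(t)`:
`Kuhlmann2010Stability.of_descent_of_algClosed` (Cor. 2.6, Cor. 2.16, Lemmas 5.1–5.2) composed
with `Kuhlmann2010StabilityAlgClosedValueTranscendental.of_parts` (Lemma 5.3). PROVED.
[cite: Kuhlmann2010, Thm. 1.1, Section 5, Lemmas 5.1–5.3] -/
theorem Kuhlmann2010Stability.of_descent_of_finiteRank (hFI : FundamentalInequality.{u})
    (hD : Kuhlmann2010DefectlessDescent.{u}) (hA : Kuhlmann2010AlgClosedFiniteRankReduction.{u})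
    (hB : Kuhlmann2010StabilityAlgClosedFiniteRank.{u}) : Kuhlmann2010Stability.{u} :=
  Kuhlmann2010Stability.of_descent_of_algClosed hFI hD
    (Kuhlmann2010StabilityAlgClosedValueTranscendental.of_parts hA hB)

end Literature.AlgebraicGeometry.Resolution
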